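import Literature.MathematicalPhysics.QuantumLattice.WilsonBlockHeatBathMarkov
import Literature.MathematicalPhysics.QuantumFieldTheory.YangMillsOS
import Literature.MathematicalPhysics.QuantumFieldTheory.LatticeGaugeProofs
import Mathlib.Data.ZMod.ValMinAbs
import HarnessLib

/-!
# The overlapping block heat-bath sampler — axis-`0` positions, depth, correlations

Theorems (no definitions) for the light-cone argument of the block heat bath of the torus Wilson theory
(Martinelli 1999 §3) on the torus of side `N = 2S+1` with `m = N/b` cells per axis:

* `natAbs_valMinAbs_cellOf_le`, `le_natAbs_valMinAbs_cellOf_shift`, `div_sub_le_min` — sites with time coordinate in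
  `[-M, M]`, resp. in `n + [-M, M]` with `M ≤ n ≤ S`, have axis-`0` cells within cyclic distance `M + 1` of `0`, resp.
  at cyclic distance `≥ min ((n−M)m/N, m−(n+M)m/N) ≥ n/b − M − 2` from `0`;
* `exists_depth` — the light-cone depth `D ≍ n/(4b)` separating the two, and `depth_numerics` — the numerics of the
  choice `t = (D+1)/(625 e²)`, `ρ₀ = min 1 (γ/(625 e²))` (`(625t)^{D+1}/(D+1)! ≤ e^{−ρ₀(D+1)}` etc.);
* `latticeConnectedCorr_eq_integral_sub`, `abs_latticeConnectedCorr_le_two_mul` — the connected torus correlation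
  with both observables read through the shifted periodic lift (translation invariance of the torus Wilson state), and
  its a priori bound `2 C_A C_B`.

References: F. Martinelli, *Lectures on Glauber dynamics for discrete spin models*, LNM 1717 (1999), §3.
-/

open scoped BigOperators
open _root_.MeasureTheory _root_.Filter
open Literature.MathematicalPhysics.QuantumFieldTheory Literature.MathematicalPhysics.QuantumLattice

noncomputable section

namespace Literature.MathematicalPhysics.QuantumLattice.WilsonBlockHeatBath

/-! ## Part C₂: axis-0 positions, depth -/
section Geometry2

/-! ### Axis-0 positions of the supports -/

/-- Sites with time coordinate in `[-M, M]` have axis-0 cell within cyclic distance `M + 1` of `0`. [folklore] -/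
theorem natAbs_valMinAbs_cellOf_le {N m M : ℕ} [NeZero N] (hm : 0 < m) (hmN : m ≤ N) (hMN : M < N)
    (a : ℤ) (ha : a.natAbs ≤ M) :
    ((cellOf N m ((a : ZMod N))).valMinAbs).natAbs ≤ M + 1 := by
  haveI : NeZero m := ⟨hm.ne'⟩
  have hN : 0 < N := Nat.pos_of_ne_zero (NeZero.ne N)
  set v := ((a : ZMod N)).val with hv
  have hvN : v < N := ZMod.val_lt _
  have hcv : (cellOf N m ((a : ZMod N))).val = v * m / N := by
    unfold cellOf
    rw [ZMod.val_natCast, Nat.mod_eq_of_lt]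
    exact Nat.div_lt_of_lt_mul (by nlinarith)
  rw [ZMod.valMinAbs_natAbs_eq_min, hcv]
  have hvZ : (v : ℤ) = a % (N : ℤ) := by rw [hv]; exact ZMod.val_intCast a
  by_cases ha0 : 0 ≤ a
  · -- `v = a ≤ M`
    have hva : (v : ℤ) = a := by
      rw [hvZ, Int.emod_eq_of_lt ha0 (by omega)]
    have hvM : v ≤ M := by omega
    refine (min_le_left _ _).trans ?_
    calc v * m / N ≤ v * N / N := Nat.div_le_div_right (Nat.mul_le_mul_left _ hmN)
      _ = v := Nat.mul_div_cancel _ hN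
      _ ≤ M + 1 := by omega
  · -- `v = a + N ≥ N - M`
    have hva : (v : ℤ) = a + N := by
      rw [hvZ]
      have : a % (N : ℤ) = a + N := by
        rw [← Int.add_emod_right, Int.emod_eq_of_lt (by omega) (by omega)]
      simpa using this
    have hvM : N ≤ v + M := by omega
    refine (min_le_right _ _).trans ?_
    -- `m ≤ v m / N + M + 1`
    have h1 : N * (m - M) ≤ v * m := by
      rcases le_or_gt M m with hMm | hMm
      · calc N * (m - M) = N * m - N * M := Nat.mul_sub N m M
          _ ≤ N * m - m * M := Nat.sub_le_sub_left (Nat.mul_le_mul_right _ hmN) _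
          _ = (N - M) * m := by rw [Nat.sub_mul, mul_comm m M]
          _ ≤ v * m := Nat.mul_le_mul_right _ (by omega)
      · simp [Nat.sub_eq_zero_of_le hMm.le]
    have h2 : m - M ≤ v * m / N := (Nat.le_div_iff_mul_le hN).2 (by rw [mul_comm]; exact h1)
    omega



/-- Sites with time coordinate in `n + [-M, M]`, `M ≤ n ≤ S`, on the torus of side `2S+1`: the
axis-0 cell is at cyclic distance `≥ min ((n-M)m/N, m - (n+M)m/N)` from `0`. [folklore] -/
theorem le_natAbs_valMinAbs_cellOf_shift {N m M n S : ℕ} [NeZero N] (hN : N = 2 * S + 1)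
    (hm : 0 < m) (hMn : M ≤ n) (hnS : n ≤ S) (a : ℤ) (ha : a.natAbs ≤ M) :
    min ((n - M) * m / N) (m - (n + M) * m / N) ≤
      ((cellOf N m (((a + n : ℤ)) : ZMod N)).valMinAbs).natAbs := by
  haveI : NeZero m := ⟨hm.ne'⟩
  have hNpos : 0 < N := Nat.pos_of_ne_zero (NeZero.ne N)
  set v := (((a + n : ℤ)) : ZMod N).val with hv
  have hvN : v < N := ZMod.val_lt _
  have hvZ : (v : ℤ) = a + n := by
    rw [hv, ZMod.val_intCast, Int.emod_eq_of_lt (by omega) (by omega)]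
  have hv1 : n - M ≤ v := by omega
  have hv2 : v ≤ n + M := by omega
  have hcv : (cellOf N m (((a + n : ℤ)) : ZMod N)).val = v * m / N := by
    unfold cellOf
    rw [ZMod.val_natCast, Nat.mod_eq_of_lt]
    exact Nat.div_lt_of_lt_mul (by nlinarith)
  rw [ZMod.valMinAbs_natAbs_eq_min, hcv]
  refine min_le_min (Nat.div_le_div_right (Nat.mul_le_mul_right _ hv1)) ?_
  exact Nat.sub_le_sub_left (Nat.div_le_div_right (Nat.mul_le_mul_right _ hv2)) _

/-- Natural division is within `1` of real division. [folklore] -/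
theorem sub_one_le_cast_div (a : ℕ) {b : ℕ} (hb : 0 < b) : (a : ℝ) / b - 1 ≤ ((a / b : ℕ) : ℝ) := by
  have hb' : (0 : ℝ) < b := by exact_mod_cast hb
  rw [sub_le_iff_le_add, div_le_iff₀ hb']
  have : (a : ℝ) < ((a / b : ℕ) : ℝ) * b + b := by exact_mod_cast Nat.lt_div_mul_add hb
  linarith

/-- The lower bound of `le_natAbs_valMinAbs_cellOf_shift` in cell units: `≥ n/b − M − 2`. [folklore] -/
theorem div_sub_le_min {N m M n S b : ℕ} (hN : N = 2 * S + 1) (hb : 1 ≤ b) (hm : m = N / b)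
    (hMn : M ≤ n) (hnS : n ≤ S) :
    (n : ℝ) / b - M - 2 ≤ ((min ((n - M) * m / N) (m - (n + M) * m / N) : ℕ) : ℝ) := by
  have hbpos : 0 < b := hb
  have hb' : (0 : ℝ) < b := by exact_mod_cast hbpos
  have hb1 : (1 : ℝ) ≤ b := by exact_mod_cast hb
  have hNpos : 0 < N := by omega
  have hN' : (0 : ℝ) < N := by exact_mod_cast hNpos
  have hNr : (N : ℝ) = 2 * S + 1 := by rw [hN]; push_cast; ring
  -- `N/b - 1 ≤ m ≤ N`
  have hm1 : (N : ℝ) / b - 1 ≤ m := by rw [hm]; exact sub_one_le_cast_div N hbpos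
  have hmN : m ≤ N := by rw [hm]; exact Nat.div_le_self N b
  have hmN' : (m : ℝ) ≤ N := by exact_mod_cast hmN
  have hm0 : (0 : ℝ) ≤ m := Nat.cast_nonneg _
  have hnS' : (n : ℝ) ≤ S := by exact_mod_cast hnS
  have hMn' : (M : ℝ) ≤ n := by exact_mod_cast hMn
  have hM0 : (0 : ℝ) ≤ M := Nat.cast_nonneg _
  have hMb : (M : ℝ) / b ≤ M := div_le_self hM0 hb1
  rw [Nat.cast_min]
  refine le_min ?_ ?_
  · -- first component
    have h1 : (((n - M) * m : ℕ) : ℝ) / N - 1 ≤ (((n - M) * m / N : ℕ) : ℝ) :=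
      sub_one_le_cast_div _ hNpos
    have hcast : (((n - M) * m : ℕ) : ℝ) = ((n : ℝ) - M) * m := by
      rw [Nat.cast_mul, Nat.cast_sub hMn]
    rw [hcast] at h1
    have h2 : ((n : ℝ) - M) * ((N : ℝ) / b - 1) ≤ ((n : ℝ) - M) * m :=
      mul_le_mul_of_nonneg_left hm1 (by linarith)
    have h3 : ((n : ℝ) - M) * ((N : ℝ) / b - 1) / N = (n - M) / b - (n - M) / N := by
      field_simp
    have h4 : ((n : ℝ) - M) / N ≤ 1 / 2 := by
      rw [div_le_iff₀ hN', hNr]; linarith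
    have h5 : ((n : ℝ) - M) * ((N : ℝ) / b - 1) / N ≤ ((n : ℝ) - M) * m / N :=
      div_le_div_of_nonneg_right h2 hN'.le
    have h6 : ((n : ℝ) - M) / b = n / b - M / b := by ring
    linarith
  · -- second component
    have h1 : (m : ℝ) ≤ ((m - (n + M) * m / N : ℕ) : ℝ) + (((n + M) * m / N : ℕ) : ℝ) := by
      exact_mod_cast le_tsub_add
    have h2 : (((n + M) * m / N : ℕ) : ℝ) ≤ (((n + M) * m : ℕ) : ℝ) / N := Nat.cast_div_le
    have hcast : (((n + M) * m : ℕ) : ℝ) = ((n : ℝ) + M) * m := by push_cast; ring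
    rw [hcast] at h2
    -- `m - (n+M) m / N = m (N - n - M)/N ≥ (N/b - 1)(N - n - M)/N`
    have hpos : (0 : ℝ) ≤ 1 - ((n : ℝ) + M) / N := by
      rw [sub_nonneg, div_le_one hN', hNr]; linarith
    have h3 : ((N : ℝ) / b - 1) * (1 - ((n : ℝ) + M) / N) ≤ m * (1 - ((n : ℝ) + M) / N) :=
      mul_le_mul_of_nonneg_right hm1 hpos
    have h4 : ((N : ℝ) / b - 1) * (1 - ((n : ℝ) + M) / N) = (N - n - M) / b - (1 - ((n : ℝ) + M) / N) := by
      field_simp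
      ring
    have h5 : (1 - ((n : ℝ) + M) / N) ≤ 1 := by
      have : 0 ≤ ((n : ℝ) + M) / N := by positivity
      linarith
    have h6 : ((n : ℝ) + 1 - M) / b ≤ ((N : ℝ) - n - M) / b :=
      div_le_div_of_nonneg_right (by rw [hNr]; linarith) hb'.le
    have h7 : ((n : ℝ) + 1 - M) / b = n / b + 1 / b - M / b := by ring
    have h8 : (0 : ℝ) ≤ 1 / b := by positivity
    have h9 : (m : ℝ) * (1 - ((n : ℝ) + M) / N) = m - ((n : ℝ) + M) * m / N := by ring
    linarith

/-- Choice of the light-cone depth `D`. [folklore] -/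
theorem exists_depth {b n M Lown : ℕ} (hb : 1 ≤ b) (hL : (n : ℝ) / b - M - 2 ≤ Lown)
    (hn : b * (2 * M + 11) ≤ n) :
    ∃ D : ℕ, 4 * D + M + 6 ≤ Lown ∧ (n : ℝ) / b ≤ 4 * (D + 1) + 2 * M + 8 := by
  have hb' : (0 : ℝ) < b := by exact_mod_cast hb
  have hnb : (2 * M + 11 : ℝ) ≤ n / b := by
    rw [le_div_iff₀ hb']
    have : ((b * (2 * M + 11) : ℕ) : ℝ) ≤ n := by exact_mod_cast hn
    push_cast at this; linarith
  have hL9 : M + 9 ≤ Lown := by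
    have : (M + 9 : ℝ) ≤ Lown := by linarith
    exact_mod_cast this
  refine ⟨(Lown - M - 6) / 4, ?_, ?_⟩
  · have := Nat.div_mul_le_self (Lown - M - 6) 4
    omega
  · have h1 : Lown - M - 6 < (Lown - M - 6) / 4 * 4 + 4 := Nat.lt_div_mul_add (by norm_num)
    have h2 : (Lown : ℝ) - M - 6 < (((Lown - M - 6) / 4 : ℕ) : ℝ) * 4 + 4 := by
      have h3 : ((Lown - M - 6 : ℕ) : ℝ) = (Lown : ℝ) - M - 6 := by
        rw [Nat.cast_sub (by omega), Nat.cast_sub (by omega)]; push_cast; ring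
      have : ((Lown - M - 6 : ℕ) : ℝ) < ((((Lown - M - 6) / 4) * 4 + 4 : ℕ) : ℝ) := by exact_mod_cast h1
      push_cast at this; linarith
    linarith


end Geometry2

/-! ## Part J: the correlation and its a priori bound -/
section APriori

variable {G : Type} [Group G] [TopologicalSpace G] [IsTopologicalGroup G] [CompactSpace G]
  [MeasurableSpace G] [BorelSpace G]

/-- The connected torus correlation written with both observables read through the shifted periodic lift
(translation invariance of the torus Wilson state moves the shift onto the mean of `B`). [folklore] -/
theorem latticeConnectedCorr_eq_integral_sub {Nρ : ℕ} (ρ : G →* Matrix (Fin Nρ) (Fin Nρ) ℂ) (β : ℝ) (N : ℕ)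
    [NeZero N] (A B : LGConfig 4 G → ℝ) (n : ℕ) :
    latticeConnectedCorr ρ β N A B n =
      (∫ U, A (configShift (-Pi.single 0 ((0 : ℕ) : ℤ)) (torusLift N U)) *
          B (configShift (-Pi.single 0 ((n : ℕ) : ℤ)) (torusLift N U)) ∂(wilsonMeasure (d := 4) (L := N) ρ β)) -
        (∫ U, A (configShift (-Pi.single 0 ((0 : ℕ) : ℤ)) (torusLift N U)) ∂(wilsonMeasure (d := 4) (L := N) ρ β)) *
          ∫ U, B (configShift (-Pi.single 0 ((n : ℕ) : ℤ)) (torusLift N U))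
            ∂(wilsonMeasure (d := 4) (L := N) ρ β) := by
  have h2 : ∫ U, B (configShift (-Pi.single 0 ((n : ℕ) : ℤ)) (torusLift N U)) ∂(wilsonMeasure (d := 4) (L := N) ρ β) =
      ∫ U, B (torusLift N U) ∂(wilsonMeasure (d := 4) (L := N) ρ β) := by
    have e1 : (fun U : GaugeConfig 4 N G => B (configShift (-Pi.single 0 ((n : ℕ) : ℤ)) (torusLift N U))) =
        toTorusObservable N (B ∘ configShift (-Pi.single 0 ((n : ℕ) : ℤ))) := rfl
    rw [e1, toTorusObservable_comp_configShift]
    exact wilsonExpectation_comp_torusConfigShift ρ β _ _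
  have h3 : ∀ U : GaugeConfig 4 N G, A (configShift (-Pi.single 0 ((0 : ℕ) : ℤ)) (torusLift N U)) =
      A (torusLift N U) := fun U => by
    simp only [Nat.cast_zero]
    congr 1; funext e; simp [configShift_apply]
  unfold latticeConnectedCorr
  rw [h2]
  simp only [h3]

/-- `|⟨A τ_n B⟩ − ⟨A⟩⟨B⟩| ≤ 2 C_A C_B` for bounded observables (the torus Wilson state is a
probability measure). [folklore] -/
theorem abs_latticeConnectedCorr_le_two_mul (r : LatticeRep G) (β : ℝ) (S : ℕ) [NeZero S]
    {A B : LGConfig 4 G → ℝ} {CA CB : ℝ} (hA : ∀ U, |A U| ≤ CA) (hB : ∀ U, |B U| ≤ CB) (n : ℕ) :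
    |latticeConnectedCorr r.ρ β S A B n| ≤ 2 * (CA * CB) := by
  -- adapted from Summit.QuantumFields.YangMills.Theorems.HypercubicLimit.Negative.abs_latticeConnectedCorr_le
  haveI := isProbabilityMeasure_wilsonMeasure (d := 4) (L := S) r.ρ r.continuous β
  have hCA0 : 0 ≤ CA := le_trans (abs_nonneg _) (hA fun _ => 1)
  have hb1 : ‖∫ U, A (torusLift S U) * B (configShift (-Pi.single 0 (n : ℤ)) (torusLift S U))
      ∂(wilsonMeasure (d := 4) (L := S) r.ρ β)‖ ≤ CA * CB := by
    refine (norm_integral_le_of_norm_le_const (C := CA * CB) ?_).trans (by simp)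
    refine Eventually.of_forall fun U => ?_
    rw [norm_mul, Real.norm_eq_abs, Real.norm_eq_abs]
    exact mul_le_mul (hA _) (hB _) (abs_nonneg _) hCA0
  have hb2 : ‖∫ U, A (torusLift S U) ∂(wilsonMeasure (d := 4) (L := S) r.ρ β)‖ ≤ CA := by
    refine (norm_integral_le_of_norm_le_const (C := CA) ?_).trans (by simp)
    exact Eventually.of_forall fun U => by rw [Real.norm_eq_abs]; exact hA _
  have hb3 : ‖∫ U, B (torusLift S U) ∂(wilsonMeasure (d := 4) (L := S) r.ρ β)‖ ≤ CB := by
    refine (norm_integral_le_of_norm_le_const (C := CB) ?_).trans (by simp)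
    exact Eventually.of_forall fun U => by rw [Real.norm_eq_abs]; exact hB _
  unfold latticeConnectedCorr
  rw [← Real.norm_eq_abs]
  refine (norm_sub_le _ _).trans ?_
  rw [norm_mul]
  have := mul_le_mul hb2 hb3 (norm_nonneg _) hCA0
  linarith

end APriori

/-! ## Part I₀: numerics of the depth/time choice -/
section Numerics


/-- Numerics of the depth/time choice `t = (D+1)/(K e²)`, `K = 625`, `ρ₀ = min 1 (γ/(K e²))`. [folklore] -/
theorem depth_numerics {γ : ℝ} (hγ : 0 < γ) (D M : ℕ) {n b : ℕ}
    (hD2 : (n : ℝ) / b ≤ 4 * (D + 1) + 2 * M + 8) :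
    0 ≤ (D + 1 : ℝ) / (625 * Real.exp 2) ∧
    (((625 : ℕ) : ℝ) * ((D + 1 : ℝ) / (625 * Real.exp 2))) ^ (D + 1) / (D + 1).factorial ≤
      Real.exp (-(min 1 (γ / (625 * Real.exp 2))) * (D + 1)) ∧
    Real.exp (-(γ * ((D + 1 : ℝ) / (625 * Real.exp 2)))) ≤
      Real.exp (-(min 1 (γ / (625 * Real.exp 2))) * (D + 1)) ∧
    Real.exp (-(min 1 (γ / (625 * Real.exp 2))) * (D + 1)) *
        Real.exp (-(min 1 (γ / (625 * Real.exp 2))) * (D + 1)) ≤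
      Real.exp ((min 1 (γ / (625 * Real.exp 2))) * (M + 4)) *
        Real.exp (-((min 1 (γ / (625 * Real.exp 2))) / 2 * n / b)) := by
  set ρ₀ : ℝ := min 1 (γ / (625 * Real.exp 2)) with hρ₀
  set t : ℝ := (D + 1 : ℝ) / (625 * Real.exp 2) with htdef
  have hρ₀pos : 0 < ρ₀ := lt_min one_pos (by positivity)
  have hρ₀1 : ρ₀ ≤ 1 := min_le_left _ _
  have hρ₀γ : ρ₀ ≤ γ / (625 * Real.exp 2) := min_le_right _ _
  have hD0 : (0 : ℝ) ≤ D + 1 := by positivity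
  have ht : 0 ≤ t := by positivity
  refine ⟨ht, ?_, ?_, ?_⟩
  · have hKt : ((625 : ℕ) : ℝ) * t = (D + 1) / Real.exp 2 := by
      rw [htdef]; push_cast; field_simp
    rw [hKt, div_pow]
    have h1 := Real.pow_div_factorial_le_exp (D + 1 : ℝ) hD0 (D + 1)
    have hexp2 : (Real.exp 2) ^ (D + 1) = Real.exp (2 * (D + 1)) := by
      rw [← Real.exp_nat_mul]; push_cast; ring_nf
    rw [hexp2]
    have h2 : (D + 1 : ℝ) ^ (D + 1) / Real.exp (2 * (D + 1)) / (D + 1).factorial =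
        ((D + 1 : ℝ) ^ (D + 1) / (D + 1).factorial) * Real.exp (-(2 * (D + 1))) := by
      rw [Real.exp_neg]; field_simp
    have h1' : (((D + 1 : ℕ) : ℝ)) ^ (D + 1) / (D + 1).factorial ≤ Real.exp (D + 1 : ℝ) := by
      have : ((D + 1 : ℕ) : ℝ) = (D + 1 : ℝ) := by push_cast; ring
      rw [this]; exact h1
    push_cast at h1' h2 ⊢
    rw [h2]
    calc ((D + 1 : ℝ) ^ (D + 1) / (D + 1).factorial) * Real.exp (-(2 * (D + 1)))
        ≤ Real.exp (D + 1) * Real.exp (-(2 * (D + 1))) :=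
          mul_le_mul_of_nonneg_right h1' (Real.exp_pos _).le
      _ = Real.exp (-(D + 1)) := by rw [← Real.exp_add]; ring_nf
      _ ≤ Real.exp (-ρ₀ * (D + 1)) := Real.exp_le_exp.2 (by nlinarith)
  · rw [Real.exp_le_exp]
    have : ρ₀ * (D + 1) ≤ γ * t := by
      rw [htdef]
      have := mul_le_mul_of_nonneg_right hρ₀γ hD0
      have e : γ / (625 * Real.exp 2) * (D + 1) = γ * ((D + 1) / (625 * Real.exp 2)) := by ring
      linarith
    linarith
  · rw [← Real.exp_add, ← Real.exp_add, Real.exp_le_exp]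
    have h1 : ρ₀ / 2 * (n : ℝ) / b = (ρ₀ / 2) * ((n : ℝ) / b) := by ring
    have h2 := mul_le_mul_of_nonneg_left hD2 (by positivity : (0 : ℝ) ≤ ρ₀ / 2)
    rw [h1]
    nlinarith


end Numerics

end Literature.MathematicalPhysics.QuantumLattice.WilsonBlockHeatBath

end
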